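import Summits.ABC.IUTFork.Conditional.AbcOfCor312SlackWindow
import Summits.ABC.IUTFork.Conditional.AbcOfSHSigmaWindow
import HarnessLib

/-!
# Branch C certificate, Σ-VARIANT INSIDE THE (P1) WINDOW: every per-datum hypothesis of `abc_of_SHSigma_v10K_window` (S_H on Σ, the weakened
# Statement with remainder `R` off Σ, the tolerance, the number-level Corollary on the depth locus) is needed ONLY at admissible `(P, l)` with
# `log(q^∀(P)) > 2^140` and `l ≥ log(q^∀(P))^{1/2}` — the Q3 interface («genuine data in Σ for `l ≫ 0`?» is asked against `l ≍ √(log q^∀)`)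

PROOF-ONLY sequel (no `def`, no new `Prop`, no instance, no notation; nothing re-typed) of this seat's `Conditional/AbcOfSHSigmaWindow.lean` (p470285,
`abc_of_SHSigma_v10K_window`, `GenuineK.cor312Slack_of_statementSlack`) and `Conditional/AbcOfCor312SlackWindow.lean` (p473109,
`Cor312Slack.ABC_of_cor312Slack_window_of_hullRegime`: [IUTchIV] Cor. 2.2 (ii) consumes Thm. 1.10's display only at the (P1)–(P3) prime and outside
`Exc_d` — `Cor22.partII_of_displayWindow`, p472503). R-H ROUND 2 seat abc-iut-rh2-q2-cond; rh-lead 2026-08-26T19:48:27Z Q3 «genuine data always in Σ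
for l ≫ 0?», Q3-typ lane «∀ genuine datum ∃ l₀, l ≥ l₀ ⇒ datum ∈ Σ». TAKES NO SIDE on [IUTchIII] Cor. 3.12 or on any author. S. Mochizuki,
*Inter-universal Teichmüller theory IV* (RIMS Apr. 2020 = PRIMS **57** (2021)), Cor. 2.2 (ii) pp. 41–48, (P1) p. 45, "`Exc_d`" p. 47
[claim: Mochizuki2012, status: disputed].

WHAT IS TYPED: **`abc_of_SHSigma_v10K_windowP1`** — for a stratum `σ` and a remainder `R` (free parameters, as in p470285), explicit 5 =
[S_H, (P1)-WINDOW∩Σ] `hSHsw` (v10K's `hSHw` VERBATIM, guarded by `σ P l T`) · [S_H|Σ-SLACK, (P1)-WINDOW∖Σ] `hSlackw` (the weakened Statement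
`↑(−|log(q)| − R) ≤ −|log(Θ)|` at the chosen realising ideles) · [TOL♯] `hTol` (`R ≤ ((l+1)/4)·(20·(1 − 12/l²) − 84/9)·d*·l` on window∖Σ) ·
[NUM, DEEP] `hNum` · [CONE] `hreg` VERBATIM — where EVERY per-datum binder except `hreg` is demanded ONLY at admissible `(P, l)` with
`2^140 < log(q^∀(P))` AND `log(q^∀(P))^{1/2} ≤ l` ⟹ `ABC` with print's constants. Proof: p470285's case split (deep ⟹ `hNum`; window ∩ Σ ⟹ v5K's
`GenuineK.cor312Of_of_SH` with `hΘ :=` p447368; window ∖ Σ ⟹ `GenuineK.cor312Slack_of_statementSlack`), slack `min (max R 0) Tol♯`, fed to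
`Cor312Slack.ABC_of_cor312Slack_window_of_hullRegime`.
READING (for Q3, numbers not adjectives): a per-datum statement «∃ l₀(P), ∀ l ≥ l₀(P), datum ∈ Σ (or R small)» closes this certificate iff
`l₀(P) ≤ log(q^∀(P))^{1/2}` for all `P` with `log(q^∀(P)) > 2^140` (`≈ 1.4·10^{42}`; so `l ≥ 2^70`); an `l₀` exponential in a local height
(the lead's 19:48:27Z HEX/frey preliminaries) against `√(log q^∀)` is the comparison the Q3-typ lane must type. HONEST FRAMING: conditional on
assumption labels for the disputed inequality; `hSHsw`/`hSlackw` are not known to be satisfiable; nothing asserts abc, Thm. 1.10 or Cor. 3.12;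
typed ≠ proved; instantiated ≠ endorsed. [cite: Mochizuki2012, IUTchIV Cor. 2.2 (ii) pp. 41–48, (P1) p. 45; IUTchIII Cor. 3.12 p. 173–174]
[cite: DupuyHilado2025, §3.3–§3.4, Thm. 3.10.1] [claim: Mochizuki2012, status: disputed]
-/

noncomputable section

open Set Function NumberField IsDedekindDomain

namespace Summit.ABC.IUTFork.Conditional

open Thm311 Thm311.Real Cor312 Cor312Vol Cor312Prov Literature.IUT.LogThetaLattice Literature.IUT.LogVolume
  Literature.IUT.HodgeTheaters Literature.IUT.LogVolume.ThetaData
open Literature.NumberTheory.DiophantineGeometry.GenEll Summit.ABC.ABC.Theorems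

/-- **`abc_of_SHSigma_v10K_windowP1`** — the Σ-variant certificate `abc_of_SHSigma_v10K_window` with every per-datum binder RESTRICTED TO THE (P1)
WINDOW `log(q^∀(P))^{1/2} ≤ l` above `log(q^∀(P)) > 2^140` (the only `(P, l)` at which [IUTchIV] Cor. 2.2 (ii) applies Thm. 1.10): explicit 5 =
S_H((P1)-window∩Σ) 1 · SLACK((P1)-window∖Σ) 1 · TOL♯ 1 · NUM((P1)-window∩deep) 1 · CONE 1 ⟹ `ABC` with print's constants. «`ABC` follows from
these hypotheses as typed» — no side taken on [IUTchIII] Cor. 3.12; typed ≠ proved; instantiated ≠ endorsed. [claim: Mochizuki2012, status: disputed] -/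
theorem abc_of_SHSigma_v10K_windowP1
    (M : ∀ (P : NFPoint) (l : ℕ) (T : Cor22.ThetaVolumeDatumAt P l), Type) [∀ P l T, Field (M P l T)] [∀ P l T, NumberField (M P l T)]
    (archPk : ∀ (P : NFPoint) (l : ℕ) (T : Cor22.ThetaVolumeDatumAt P l), letI := T.instFieldF; letI := T.instNumberFieldF; letI := T.instAlgebraF; letI := T.instFieldK;
        letI := T.instNumberFieldK; letI := T.instAlgebraK; letI := T.instFieldFbar; letI := T.instAlgebraFbar;
        letI := T.instAlgebraKFbar; letI := T.instIsElliptic;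
      ∀ (j : (thetaIndex (pilotDataOfK T.D T.K)).Label) (vQ : (thetaIndex (pilotDataOfK T.D T.K)).VQ), Set ((logShellsDH (pilotDataOfK T.D T.K) (analyticLogv T.K)).Packet j vQ))
    (archSub : ∀ (P : NFPoint) (l : ℕ) (T : Cor22.ThetaVolumeDatumAt P l), letI := T.instFieldF; letI := T.instNumberFieldF; letI := T.instAlgebraF; letI := T.instFieldK;
        letI := T.instNumberFieldK; letI := T.instAlgebraK; letI := T.instFieldFbar; letI := T.instAlgebraFbar;
        letI := T.instAlgebraKFbar; letI := T.instIsElliptic;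
      ∀ (j : (thetaIndex (pilotDataOfK T.D T.K)).Label) (v : (thetaIndex (pilotDataOfK T.D T.K)).V), Set ((logShellsDH (pilotDataOfK T.D T.K) (analyticLogv T.K)).Packet j ((thetaIndex (pilotDataOfK T.D T.K)).over v)))
    (Ψ : ∀ (P : NFPoint) (l : ℕ) (T : Cor22.ThetaVolumeDatumAt P l), letI := T.instFieldF; letI := T.instNumberFieldF; letI := T.instAlgebraF; letI := T.instFieldK;
        letI := T.instNumberFieldK; letI := T.instAlgebraK; letI := T.instFieldFbar; letI := T.instAlgebraFbar;
        letI := T.instAlgebraKFbar; letI := T.instIsElliptic;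
      ℤ → ∀ v : (thetaIndex (pilotDataOfK T.D T.K)).V, v ∈ (thetaIndex (pilotDataOfK T.D T.K)).Vbad → Set ((logShellsDH (pilotDataOfK T.D T.K) (analyticLogv T.K)).StarPacket v))
    (act : ∀ (P : NFPoint) (l : ℕ) (T : Cor22.ThetaVolumeDatumAt P l), letI := T.instFieldF; letI := T.instNumberFieldF; letI := T.instAlgebraF; letI := T.instFieldK;
        letI := T.instNumberFieldK; letI := T.instAlgebraK; letI := T.instFieldFbar; letI := T.instAlgebraFbar;
        letI := T.instAlgebraKFbar; letI := T.instIsElliptic;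
      ℤ → ∀ v : (thetaIndex (pilotDataOfK T.D T.K)).V, v ∈ (thetaIndex (pilotDataOfK T.D T.K)).Vbad → (logShellsDH (pilotDataOfK T.D T.K) (analyticLogv T.K)).StarPacket v → Module.End ℚ ((logShellsDH (pilotDataOfK T.D T.K) (analyticLogv T.K)).StarPacket v))
    (Mmod : ∀ (P : NFPoint) (l : ℕ) (T : Cor22.ThetaVolumeDatumAt P l), letI := T.instFieldF; letI := T.instNumberFieldF; letI := T.instAlgebraF; letI := T.instFieldK;
        letI := T.instNumberFieldK; letI := T.instAlgebraK; letI := T.instFieldFbar; letI := T.instAlgebraFbar;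
        letI := T.instAlgebraKFbar; letI := T.instIsElliptic;
      ℤ → ∀ j : (thetaIndex (pilotDataOfK T.D T.K)).LabelStar, Set ((logShellsDH (pilotDataOfK T.D T.K) (analyticLogv T.K)).GlobalPacket j.1))
    (region : ∀ (P : NFPoint) (l : ℕ) (T : Cor22.ThetaVolumeDatumAt P l), letI := T.instFieldF; letI := T.instNumberFieldF; letI := T.instAlgebraF; letI := T.instFieldK;
        letI := T.instNumberFieldK; letI := T.instAlgebraK; letI := T.instFieldFbar; letI := T.instAlgebraFbar;
        letI := T.instAlgebraKFbar; letI := T.instIsElliptic;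
      ℤ → ∀ j : (thetaIndex (pilotDataOfK T.D T.K)).LabelStar, FinDivisor (M P l T) → ∀ vQ : (thetaIndex (pilotDataOfK T.D T.K)).VQ, Set ((logShellsDH (pilotDataOfK T.D T.K) (analyticLogv T.K)).Packet j.1 vQ))
    (frobAdm : ∀ (P : NFPoint) (l : ℕ) (T : Cor22.ThetaVolumeDatumAt P l), letI := T.instFieldF; letI := T.instNumberFieldF; letI := T.instAlgebraF; letI := T.instFieldK;
        letI := T.instNumberFieldK; letI := T.instAlgebraK; letI := T.instFieldFbar; letI := T.instAlgebraFbar;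
        letI := T.instAlgebraKFbar; letI := T.instIsElliptic;
      ℤ → ℤ → ∀ (j : (thetaIndex (pilotDataOfK T.D T.K)).Label) (vQ : (thetaIndex (pilotDataOfK T.D T.K)).VQ), Set ((logShellsDH (pilotDataOfK T.D T.K) (analyticLogv T.K)).Packet j vQ) → Prop)
    (frobLogvol : ∀ (P : NFPoint) (l : ℕ) (T : Cor22.ThetaVolumeDatumAt P l), letI := T.instFieldF; letI := T.instNumberFieldF; letI := T.instAlgebraF; letI := T.instFieldK;
        letI := T.instNumberFieldK; letI := T.instAlgebraK; letI := T.instFieldFbar; letI := T.instAlgebraFbar;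
        letI := T.instAlgebraKFbar; letI := T.instIsElliptic;
      ℤ → ℤ → ∀ (j : (thetaIndex (pilotDataOfK T.D T.K)).Label) (vQ : (thetaIndex (pilotDataOfK T.D T.K)).VQ), Set ((logShellsDH (pilotDataOfK T.D T.K) (analyticLogv T.K)).Packet j vQ) → ℝ)
    (frobΨ : ∀ (P : NFPoint) (l : ℕ) (T : Cor22.ThetaVolumeDatumAt P l), letI := T.instFieldF; letI := T.instNumberFieldF; letI := T.instAlgebraF; letI := T.instFieldK;
        letI := T.instNumberFieldK; letI := T.instAlgebraK; letI := T.instFieldFbar; letI := T.instAlgebraFbar;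
        letI := T.instAlgebraKFbar; letI := T.instIsElliptic;
      ℤ → ℤ → ∀ v : (thetaIndex (pilotDataOfK T.D T.K)).V, v ∈ (thetaIndex (pilotDataOfK T.D T.K)).Vbad → Set ((logShellsDH (pilotDataOfK T.D T.K) (analyticLogv T.K)).StarPacket v))
    (frobMmod : ∀ (P : NFPoint) (l : ℕ) (T : Cor22.ThetaVolumeDatumAt P l), letI := T.instFieldF; letI := T.instNumberFieldF; letI := T.instAlgebraF; letI := T.instFieldK;
        letI := T.instNumberFieldK; letI := T.instAlgebraK; letI := T.instFieldFbar; letI := T.instAlgebraFbar;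
        letI := T.instAlgebraKFbar; letI := T.instIsElliptic;
      ℤ → ℤ → ∀ j : (thetaIndex (pilotDataOfK T.D T.K)).LabelStar, Set ((logShellsDH (pilotDataOfK T.D T.K) (analyticLogv T.K)).GlobalPacket j.1))
    (unitImage : ∀ (P : NFPoint) (l : ℕ) (T : Cor22.ThetaVolumeDatumAt P l), letI := T.instFieldF; letI := T.instNumberFieldF; letI := T.instAlgebraF; letI := T.instFieldK;
        letI := T.instNumberFieldK; letI := T.instAlgebraK; letI := T.instFieldFbar; letI := T.instAlgebraFbar;
        letI := T.instAlgebraKFbar; letI := T.instIsElliptic;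
      ℤ → ℤ → ℕ → ∀ (j : (thetaIndex (pilotDataOfK T.D T.K)).Label) (vQ : (thetaIndex (pilotDataOfK T.D T.K)).VQ), Set ((logShellsDH (pilotDataOfK T.D T.K) (analyticLogv T.K)).Packet j vQ))
    (ballImage : ∀ (P : NFPoint) (l : ℕ) (T : Cor22.ThetaVolumeDatumAt P l), letI := T.instFieldF; letI := T.instNumberFieldF; letI := T.instAlgebraF; letI := T.instFieldK;
        letI := T.instNumberFieldK; letI := T.instAlgebraK; letI := T.instFieldFbar; letI := T.instAlgebraFbar;
        letI := T.instAlgebraKFbar; letI := T.instIsElliptic;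
      ℤ → ℤ → ∀ (j : (thetaIndex (pilotDataOfK T.D T.K)).Label) (vQ : (thetaIndex (pilotDataOfK T.D T.K)).VQ), Set ((logShellsDH (pilotDataOfK T.D T.K) (analyticLogv T.K)).Packet j vQ))
    (thetaDiv : ∀ (P : NFPoint) (l : ℕ) (T : Cor22.ThetaVolumeDatumAt P l), letI := T.instFieldF; letI := T.instNumberFieldF; letI := T.instAlgebraF; letI := T.instFieldK;
        letI := T.instNumberFieldK; letI := T.instAlgebraK; letI := T.instFieldFbar; letI := T.instAlgebraFbar;
        letI := T.instAlgebraKFbar; letI := T.instIsElliptic;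
      ℤ → ℤ → LgpDivisor (M P l T) (thetaIndex (pilotDataOfK T.D T.K)).lstar)
    (n : ∀ (P : NFPoint) (l : ℕ) (T : Cor22.ThetaVolumeDatumAt P l), ℤ)
    {HT : ∀ (P : NFPoint) (l : ℕ) (T : Cor22.ThetaVolumeDatumAt P l), Type} {LogLink : ∀ (P : NFPoint) (l : ℕ) (T : Cor22.ThetaVolumeDatumAt P l), HT P l T → HT P l T → Type}
    {IsFull : ∀ (P : NFPoint) (l : ℕ) (T : Cor22.ThetaVolumeDatumAt P l), ∀ {s t : HT P l T}, LogLink P l T s t → Prop}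
    (lat : ∀ (P : NFPoint) (l : ℕ) (T : Cor22.ThetaVolumeDatumAt P l), LGPGaussianLogThetaLattice (LogLink P l T) (IsFull P l T))
    {Frd : ∀ (P : NFPoint) (l : ℕ) (T : Cor22.ThetaVolumeDatumAt P l), Type} {IsoF : ∀ (P : NFPoint) (l : ℕ) (T : Cor22.ThetaVolumeDatumAt P l), Frd P l T → Frd P l T → Type} {Ob : ∀ (P : NFPoint) (l : ℕ) (T : Cor22.ThetaVolumeDatumAt P l), Frd P l T → Type}
    {realify : ∀ (P : NFPoint) (l : ℕ) (T : Cor22.ThetaVolumeDatumAt P l), Frd P l T → Frd P l T} {Strip : ∀ (P : NFPoint) (l : ℕ) (T : Cor22.ThetaVolumeDatumAt P l), Type} {IsoS : ∀ (P : NFPoint) (l : ℕ) (T : Cor22.ThetaVolumeDatumAt P l), Strip P l T → Strip P l T → Type}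
    {Mv : ∀ (P : NFPoint) (l : ℕ) (T : Cor22.ThetaVolumeDatumAt P l), letI := T.instFieldF; letI := T.instNumberFieldF; letI := T.instAlgebraF; letI := T.instFieldK;
        letI := T.instNumberFieldK; letI := T.instAlgebraK; letI := T.instFieldFbar; letI := T.instAlgebraFbar;
        letI := T.instAlgebraKFbar; letI := T.instIsElliptic;
      ∀ v : (thetaIndex (pilotDataOfK T.D T.K)).V, v ∈ (thetaIndex (pilotDataOfK T.D T.K)).Vbad → Type}
    [∀ P l T v h, Monoid (Mv P l T v h)]
    (sig : ∀ (P : NFPoint) (l : ℕ) (T : Cor22.ThetaVolumeDatumAt P l), letI := T.instFieldF; letI := T.instNumberFieldF; letI := T.instAlgebraF; letI := T.instFieldK;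
        letI := T.instNumberFieldK; letI := T.instAlgebraK; letI := T.instFieldFbar; letI := T.instAlgebraFbar;
        letI := T.instAlgebraKFbar; letI := T.instIsElliptic;
      GlobalLGPFrobenioidSignature (thetaIndex (pilotDataOfK T.D T.K)).lstar (thetaIndex (pilotDataOfK T.D T.K)).V (· ∈ (thetaIndex (pilotDataOfK T.D T.K)).Vbad) (Frd P l T) (IsoF P l T) (Ob P l T) (realify P l T)
        (Strip P l T) (IsoS P l T) (Mv P l T))
    (split : ∀ (P : NFPoint) (l : ℕ) (T : Cor22.ThetaVolumeDatumAt P l), SplittingMonoids (Mv P l T))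
    {ObΔ : ∀ (P : NFPoint) (l : ℕ) (T : Cor22.ThetaVolumeDatumAt P l), Type} {N : ∀ (P : NFPoint) (l : ℕ) (T : Cor22.ThetaVolumeDatumAt P l), letI := T.instFieldF; letI := T.instNumberFieldF; letI := T.instAlgebraF; letI := T.instFieldK;
        letI := T.instNumberFieldK; letI := T.instAlgebraK; letI := T.instFieldFbar; letI := T.instAlgebraFbar;
        letI := T.instAlgebraKFbar; letI := T.instIsElliptic;
      ∀ v : (thetaIndex (pilotDataOfK T.D T.K)).V, v ∈ (thetaIndex (pilotDataOfK T.D T.K)).Vbad → Type}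
    [∀ P l T v h, Monoid (N P l T v h)] (qData : ∀ (P : NFPoint) (l : ℕ) (T : Cor22.ThetaVolumeDatumAt P l), QPilotData (ObΔ P l T) (N P l T))
    (qK : ∀ (P : NFPoint) (l : ℕ) (T : Cor22.ThetaVolumeDatumAt P l), letI := T.instFieldF; letI := T.instNumberFieldF; letI := T.instAlgebraF; letI := T.instFieldK;
        letI := T.instNumberFieldK; letI := T.instAlgebraK; letI := T.instFieldFbar; letI := T.instAlgebraFbar;
        letI := T.instAlgebraKFbar; letI := T.instIsElliptic;
      ∀ v : (thetaIndex (pilotDataOfK T.D T.K)).V, v ∈ (thetaIndex (pilotDataOfK T.D T.K)).Vbad → Set ((logShellsDH (pilotDataOfK T.D T.K) (analyticLogv T.K)).StarPacket v))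
    (σ : ∀ (P : NFPoint) (l : ℕ), Cor22.ThetaVolumeDatumAt P l → Prop) (R : ∀ (P : NFPoint) (l : ℕ), Cor22.ThetaVolumeDatumAt P l → ℝ)
    -- [S_H, (P1)-WINDOW ∩ Σ] v10K's `hSHw` VERBATIM, demanded ONLY at admissible `(P,l)` with `2^140 < log q∀(P)`, `√(log q∀(P)) ≤ l`, OFF the depth locus, IN `σ`
    (hSHsw : ∀ (P : NFPoint), P ∈ UP → ∀ (l : ℕ), l.Prime → 5 ≤ l →
      Cor22.AdmitsCore P → Cor22.CondP2 P l → Cor22.CondP5 P l → Cor22.CondP6 P l →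
      (2 : ℝ) ^ 140 < Cor22.logQForall P → Real.sqrt (Cor22.logQForall P) ≤ l →
      ∀ (T : Cor22.ThetaVolumeDatumAt P l), letI := T.instFieldF; letI := T.instNumberFieldF; letI := T.instAlgebraF; letI := T.instFieldK;
        letI := T.instNumberFieldK; letI := T.instAlgebraK; letI := T.instFieldFbar; letI := T.instAlgebraFbar;
        letI := T.instAlgebraKFbar; letI := T.instIsElliptic;
      ¬ (∃ (pp : Nat.Primes) (_ : 2 < (pp : ℕ)) (i : Fin (thetaIndex (pilotDataOfK T.D T.K)).lstar)
          (x₀ : (thetaIndex (pilotDataOfK T.D T.K)).Fibre (.inr pp)),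
        haveI : Fact (pp : ℕ).Prime := ⟨pp.2⟩
        ((pp : ℕ) : ℝ) ^ ((((i : ℕ) : ℝ) + 2) * (4 + 2 * Real.logb (pp : ℕ) (Module.finrank ℚ T.K)) + 1) *
          ‖(exists_realising_qIdeles_pilotDataOfK T.D).choose pp x₀‖ ^ (((i : ℕ) + 1) ^ 2 - 1) < 1) → σ P l T →
      Cor312Vol.PilotKummerCompatHull
        (LatticeSituation.ofShells (logShellsDH (pilotDataOfK T.D T.K) (analyticLogv T.K)) (M P l T) (archPk P l T)
          (archSub P l T) (summandPiecesPr (pilotDataOfK T.D T.K) (logvAnalytic_analyticLogv (F := T.K))).Adm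
          (summandPiecesPr (pilotDataOfK T.D T.K) (logvAnalytic_analyticLogv (F := T.K))).logvol (Ψ P l T) (act P l T) (Mmod P l T)
          (region P l T) (frobAdm P l T) (frobLogvol P l T) (frobΨ P l T) (frobMmod P l T) (unitImage P l T)
          (ballImage P l T) (thetaDiv P l T))
        (settingPrVolSharp (pilotDataOfK T.D T.K) (logvAnalytic_analyticLogv (F := T.K)) (M P l T) (archPk P l T) (archSub P l T) (Ψ P l T)
          (act P l T) (Mmod P l T) (region P l T) (n P l T) (lat P l T) (sig P l T) (split P l T) (qData P l T)
          (exists_realising_qIdeles_pilotDataOfK T.D).choose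
          (exists_realising_thetaIdeles_pilotDataOfK T.D).choose
          (exists_realising_qIdeles_pilotDataOfK T.D).choose_spec.1
          (exists_realising_qIdeles_pilotDataOfK T.D).choose_spec.2.1)
        (fun _ => Cor312.Setting.qRegion
        (settingPrVolSharp (pilotDataOfK T.D T.K) (logvAnalytic_analyticLogv (F := T.K)) (M P l T) (archPk P l T) (archSub P l T) (Ψ P l T)
          (act P l T) (Mmod P l T) (region P l T) (n P l T) (lat P l T) (sig P l T) (split P l T) (qData P l T)
          (exists_realising_qIdeles_pilotDataOfK T.D).choose
          (exists_realising_thetaIdeles_pilotDataOfK T.D).choose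
          (exists_realising_qIdeles_pilotDataOfK T.D).choose_spec.1
          (exists_realising_qIdeles_pilotDataOfK T.D).choose_spec.2.1)) (qK P l T))
    -- [S_H|Σ-SLACK, (P1)-WINDOW ∖ Σ] the WEAKENED Statement at the chosen realising ideles with slack `R P l T`
    (hSlackw : ∀ (P : NFPoint), P ∈ UP → ∀ (l : ℕ), l.Prime → 5 ≤ l →
      Cor22.AdmitsCore P → Cor22.CondP2 P l → Cor22.CondP5 P l → Cor22.CondP6 P l →
      (2 : ℝ) ^ 140 < Cor22.logQForall P → Real.sqrt (Cor22.logQForall P) ≤ l →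
      ∀ (T : Cor22.ThetaVolumeDatumAt P l), letI := T.instFieldF; letI := T.instNumberFieldF; letI := T.instAlgebraF; letI := T.instFieldK;
        letI := T.instNumberFieldK; letI := T.instAlgebraK; letI := T.instFieldFbar; letI := T.instAlgebraFbar;
        letI := T.instAlgebraKFbar; letI := T.instIsElliptic;
      ¬ (∃ (pp : Nat.Primes) (_ : 2 < (pp : ℕ)) (i : Fin (thetaIndex (pilotDataOfK T.D T.K)).lstar)
          (x₀ : (thetaIndex (pilotDataOfK T.D T.K)).Fibre (.inr pp)),
        haveI : Fact (pp : ℕ).Prime := ⟨pp.2⟩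
        ((pp : ℕ) : ℝ) ^ ((((i : ℕ) : ℝ) + 2) * (4 + 2 * Real.logb (pp : ℕ) (Module.finrank ℚ T.K)) + 1) *
          ‖(exists_realising_qIdeles_pilotDataOfK T.D).choose pp x₀‖ ^ (((i : ℕ) + 1) ^ 2 - 1) < 1) → ¬ σ P l T →
      ((((settingPrVolSharp (pilotDataOfK T.D T.K) (logvAnalytic_analyticLogv (F := T.K)) (M P l T) (archPk P l T) (archSub P l T) (Ψ P l T)
          (act P l T) (Mmod P l T) (region P l T) (n P l T) (lat P l T) (sig P l T) (split P l T) (qData P l T)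
          (exists_realising_qIdeles_pilotDataOfK T.D).choose
          (exists_realising_thetaIdeles_pilotDataOfK T.D).choose
          (exists_realising_qIdeles_pilotDataOfK T.D).choose_spec.1
          (exists_realising_qIdeles_pilotDataOfK T.D).choose_spec.2.1).negLogQ - R P l T : ℝ)) : WithTop ℝ) ≤
        (settingPrVolSharp (pilotDataOfK T.D T.K) (logvAnalytic_analyticLogv (F := T.K)) (M P l T) (archPk P l T) (archSub P l T) (Ψ P l T)
          (act P l T) (Mmod P l T) (region P l T) (n P l T) (lat P l T) (sig P l T) (split P l T) (qData P l T)
          (exists_realising_qIdeles_pilotDataOfK T.D).choose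
          (exists_realising_thetaIdeles_pilotDataOfK T.D).choose
          (exists_realising_qIdeles_pilotDataOfK T.D).choose_spec.1
          (exists_realising_qIdeles_pilotDataOfK T.D).choose_spec.2.1).negLogTheta)
    -- [TOL♯, (P1)-WINDOW ∖ Σ] the remainder is within the SHARP no-loss tolerance of `Cor312Slack.display_of_squeezeIII_slack_sharp`
    (hTol : ∀ (P : NFPoint), P ∈ UP → ∀ (l : ℕ), l.Prime → 5 ≤ l →
      Cor22.AdmitsCore P → Cor22.CondP2 P l → Cor22.CondP5 P l → Cor22.CondP6 P l →
      (2 : ℝ) ^ 140 < Cor22.logQForall P → Real.sqrt (Cor22.logQForall P) ≤ l →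
      ∀ (T : Cor22.ThetaVolumeDatumAt P l), letI := T.instFieldF; letI := T.instNumberFieldF; letI := T.instAlgebraF; letI := T.instFieldK;
        letI := T.instNumberFieldK; letI := T.instAlgebraK; letI := T.instFieldFbar; letI := T.instAlgebraFbar;
        letI := T.instAlgebraKFbar; letI := T.instIsElliptic;
      ¬ (∃ (pp : Nat.Primes) (_ : 2 < (pp : ℕ)) (i : Fin (thetaIndex (pilotDataOfK T.D T.K)).lstar)
          (x₀ : (thetaIndex (pilotDataOfK T.D T.K)).Fibre (.inr pp)),
        haveI : Fact (pp : ℕ).Prime := ⟨pp.2⟩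
        ((pp : ℕ) : ℝ) ^ ((((i : ℕ) : ℝ) + 2) * (4 + 2 * Real.logb (pp : ℕ) (Module.finrank ℚ T.K)) + 1) *
          ‖(exists_realising_qIdeles_pilotDataOfK T.D).choose pp x₀‖ ^ (((i : ℕ) + 1) ^ 2 - 1) < 1) → ¬ σ P l T → R P l T ≤ ((l : ℝ) + 1) / 4 * ((20 * (1 - 12 / (l : ℝ) ^ 2) - 84 / 9) * ((((2 ^ 12 * 3 ^ 3 * 5 * Cor22.dmod P : ℕ) : ℝ)) * l)))
    -- [NUM, (P1)-WINDOW ∩ DEEP] the NUMBER-level Corollary 3.12 at the datum, ONLY at windowed admissible data ON the depth locus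
    (hNum : ∀ (P : NFPoint), P ∈ UP → ∀ (l : ℕ), l.Prime → 5 ≤ l →
      Cor22.AdmitsCore P → Cor22.CondP2 P l → Cor22.CondP5 P l → Cor22.CondP6 P l →
      (2 : ℝ) ^ 140 < Cor22.logQForall P → Real.sqrt (Cor22.logQForall P) ≤ l →
      ∀ (T : Cor22.ThetaVolumeDatumAt P l), letI := T.instFieldF; letI := T.instNumberFieldF; letI := T.instAlgebraF; letI := T.instFieldK;
        letI := T.instNumberFieldK; letI := T.instAlgebraK; letI := T.instFieldFbar; letI := T.instAlgebraFbar;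
        letI := T.instAlgebraKFbar; letI := T.instIsElliptic;
      (∃ (pp : Nat.Primes) (_ : 2 < (pp : ℕ)) (i : Fin (thetaIndex (pilotDataOfK T.D T.K)).lstar)
          (x₀ : (thetaIndex (pilotDataOfK T.D T.K)).Fibre (.inr pp)),
        haveI : Fact (pp : ℕ).Prime := ⟨pp.2⟩
        ((pp : ℕ) : ℝ) ^ ((((i : ℕ) : ℝ) + 2) * (4 + 2 * Real.logb (pp : ℕ) (Module.finrank ℚ T.K)) + 1) *
          ‖(exists_realising_qIdeles_pilotDataOfK T.D).choose pp x₀‖ ^ (((i : ℕ) + 1) ^ 2 - 1) < 1) → T.Cor312Of)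
    (hreg : ∀ P : NFPoint, P ∈ UP → ∀ l : ℕ, l.Prime → 5 ≤ l →
      Cor22.AdmitsCore P → Cor22.CondP2 P l → Cor22.CondP5 P l → Cor22.CondP6 P l →
      ∀ T : Cor22.ThetaVolumeDatumAt P l,
        (letI := T.instFieldF; letI := T.instNumberFieldF; letI := T.instAlgebraF; letI := T.instFieldK
         letI := T.instNumberFieldK; letI := T.instAlgebraK; letI := T.instFieldFbar; letI := T.instAlgebraFbar
         letI := T.instAlgebraKFbar; letI := T.instIsElliptic
         ¬ (∀ p ∈ T.I.supportPrimes, ∀ v w : placesOver (fieldOfModuli T.E) p,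
            (Summit.ABC.IUTFork.DHData.ofInput T.I).logQloc p v = (Summit.ABC.IUTFork.DHData.ofInput T.I).logQloc p w)) →
        T.HullEstimateOf
          (((l : ℝ) + 1) / 4 *
            ((1 + 12 * (Cor22.dmod P : ℝ) / l) * (P.logDiff + Cor22.logCondAvoid P {2, l})
              + 2 * Real.log l + 52
              + 20 / 3 * Real.log (((2 ^ 12 * 3 ^ 3 * 5 * Cor22.dmod P : ℕ) : ℝ) * (l : ℝ))
                * (Nat.primeCounting (2 ^ 12 * 3 ^ 3 * 5 * Cor22.dmod P * l) : ℝ))))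
    : _root_.ABC := by
  refine Cor312Slack.ABC_of_cor312Slack_window_of_hullRegime
    (fun P l T => min (max (R P l T) 0) (((l : ℝ) + 1) / 4 * ((20 * (1 - 12 / (l : ℝ) ^ 2) - 84 / 9) * ((((2 ^ 12 * 3 ^ 3 * 5 * Cor22.dmod P : ℕ) : ℝ)) * l))))
    (fun P hP l hl h5 hc h2 h5' h6 h140 hlo T => ?_) (fun P _ l _ _ _ _ _ _ _ _ T => min_le_right _ _) hreg
  letI := T.instFieldF; letI := T.instNumberFieldF; letI := T.instAlgebraF; letI := T.instFieldK
  letI := T.instNumberFieldK; letI := T.instAlgebraK; letI := T.instFieldFbar; letI := T.instAlgebraFbar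
  letI := T.instAlgebraKFbar; letI := T.instIsElliptic
  have hne : l ≠ 5 := by
    rintro rfl
    obtain ⟨F, hNF, hF⟩ := Cor22.exists_isThetaField P hP.1
    haveI := hNF
    exact Cor22.not_condP6_five_of_isThetaField hP.1 F hF h6
  have hl7 : (7 : ℝ) ≤ l := by exact_mod_cast Cor312Slack.seven_le_of_prime_of_ne_five hl h5 hne
  have hTol0 : (0 : ℝ) ≤ ((l : ℝ) + 1) / 4 * ((20 * (1 - 12 / (l : ℝ) ^ 2) - 84 / 9) * ((((2 ^ 12 * 3 ^ 3 * 5 * Cor22.dmod P : ℕ) : ℝ)) * l)) := by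
    have hcS : (0 : ℝ) ≤ 20 * (1 - 12 / (l : ℝ) ^ 2) - 84 / 9 := le_trans (by norm_num) (Cor312Slack.five_le_sharpCoeff hl7)
    positivity
  have hε0 : (0 : ℝ) ≤ min (max (R P l T) 0) (((l : ℝ) + 1) / 4 * ((20 * (1 - 12 / (l : ℝ) ^ 2) - 84 / 9) * ((((2 ^ 12 * 3 ^ 3 * 5 * Cor22.dmod P : ℕ) : ℝ)) * l))) :=
    le_min (le_max_right _ _) hTol0
  -- the Θ-side identification at the chosen ideles is abc-iut-s2-p6's THEOREM p447368
  have hΘ := negLogTheta_settingPrVolSharp_pilotDataOfK_le_datum T (M P l T) (archPk P l T) (archSub P l T) (Ψ P l T) (act P l T)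
    (Mmod P l T) (region P l T) (n P l T) (lat P l T) (sig P l T) (split P l T) (qData P l T)
    (exists_realising_qIdeles_pilotDataOfK T.D).choose (exists_realising_thetaIdeles_pilotDataOfK T.D).choose
    (exists_realising_qIdeles_pilotDataOfK T.D).choose_spec.1 (exists_realising_qIdeles_pilotDataOfK T.D).choose_spec.2.1
    (exists_realising_thetaIdeles_pilotDataOfK T.D).choose_spec.1 (exists_realising_thetaIdeles_pilotDataOfK T.D).choose_spec.2.2
  by_cases hdeep : (∃ (pp : Nat.Primes) (_ : 2 < (pp : ℕ)) (i : Fin (thetaIndex (pilotDataOfK T.D T.K)).lstar)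
          (x₀ : (thetaIndex (pilotDataOfK T.D T.K)).Fibre (.inr pp)),
        haveI : Fact (pp : ℕ).Prime := ⟨pp.2⟩
        ((pp : ℕ) : ℝ) ^ ((((i : ℕ) : ℝ) + 2) * (4 + 2 * Real.logb (pp : ℕ) (Module.finrank ℚ T.K)) + 1) *
          ‖(exists_realising_qIdeles_pilotDataOfK T.D).choose pp x₀‖ ^ (((i : ℕ) + 1) ^ 2 - 1) < 1)
  · have h := (hNum P hP l hl h5 hc h2 h5' h6 h140 hlo T hdeep)
    rw [Cor22.ThetaVolumeDatumAt.cor312Of_iff] at h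
    linarith
  by_cases hσ : σ P l T
  · have h : T.Cor312Of := GenuineK.cor312Of_of_SH T.D T.K (M P l T) (archPk P l T) (archSub P l T) (Ψ P l T) (act P l T) (Mmod P l T)
      (region P l T) (frobAdm P l T) (frobLogvol P l T) (frobΨ P l T) (frobMmod P l T) (unitImage P l T) (ballImage P l T)
      (thetaDiv P l T) (n P l T) (lat P l T) (sig P l T) (split P l T) (qData P l T)
      (exists_realising_thetaIdeles_pilotDataOfK T.D).choose (exists_realising_qIdeles_pilotDataOfK T.D).choose
      (fun _ => Cor312.Setting.qRegion
          (settingPrVolSharp (pilotDataOfK T.D T.K) (logvAnalytic_analyticLogv (F := T.K)) (M P l T) (archPk P l T) (archSub P l T) (Ψ P l T)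
          (act P l T) (Mmod P l T) (region P l T) (n P l T) (lat P l T) (sig P l T) (split P l T) (qData P l T)
          (exists_realising_qIdeles_pilotDataOfK T.D).choose
          (exists_realising_thetaIdeles_pilotDataOfK T.D).choose
          (exists_realising_qIdeles_pilotDataOfK T.D).choose_spec.1
          (exists_realising_qIdeles_pilotDataOfK T.D).choose_spec.2.1)) (qK P l T)
      T.isVolumeInputOf (exists_realising_qIdeles_pilotDataOfK T.D).choose_spec.1
      (exists_realising_qIdeles_pilotDataOfK T.D).choose_spec.2.1 (exists_realising_thetaIdeles_pilotDataOfK T.D).choose_spec.1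
      (exists_realising_thetaIdeles_pilotDataOfK T.D).choose_spec.2.1 (exists_realising_qIdeles_pilotDataOfK T.D).choose_spec.2.2
      (hSHsw P hP l hl h5 hc h2 h5' h6 h140 hlo T hdeep hσ) (fun _ _ => rfl) hΘ
    rw [Cor22.ThetaVolumeDatumAt.cor312Of_iff] at h
    linarith
  · have h := GenuineK.cor312Slack_of_statementSlack T.D T.K (M P l T) (archPk P l T) (archSub P l T) (Ψ P l T) (act P l T) (Mmod P l T)
      (region P l T) (n P l T) (lat P l T) (sig P l T) (split P l T) (qData P l T)
      (exists_realising_thetaIdeles_pilotDataOfK T.D).choose (exists_realising_qIdeles_pilotDataOfK T.D).choose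
      T.isVolumeInputOf (exists_realising_qIdeles_pilotDataOfK T.D).choose_spec.1
      (exists_realising_qIdeles_pilotDataOfK T.D).choose_spec.2.1 (exists_realising_qIdeles_pilotDataOfK T.D).choose_spec.2.2
      (hSlackw P hP l hl h5 hc h2 h5' h6 h140 hlo T hdeep hσ) hΘ
    have hR : R P l T ≤ min (max (R P l T) 0) (((l : ℝ) + 1) / 4 * ((20 * (1 - 12 / (l : ℝ) ^ 2) - 84 / 9) * ((((2 ^ 12 * 3 ^ 3 * 5 * Cor22.dmod P : ℕ) : ℝ)) * l))) :=
      le_min (le_max_left _ _) (hTol P hP l hl h5 hc h2 h5' h6 h140 hlo T hdeep hσ)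
    have h' : T.negAbsLogQ ≤ T.negLogTheta + R P l T := h
    linarith

end Summit.ABC.IUTFork.Conditional

end
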